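import Summits.CriticalPhenomena.PercolationContinuityZ3.Theorems.PercNearOneGluingNoHeavyLowerTailSahiGridPatternMeetFace
import Summits.CriticalPhenomena.PercolationContinuityZ3.Theorems.PercNearOneGluingNoHeavyLowerTailSahiGridPatternZeroLocusIndep

/-!
# `NoHeavyLowerTail` (crux stmt-CriticalPhenomena-4575), Sahi programme P1: **THE MEET FACE DOMINATES ITS HARRIS SLACK, EVERY DIMENSION**
# — `A ∩ B ⊆ C ⟹ sStarD A B C ≥ H(A, B∩C)` and `≥ H(B, A∩C)`

Support file (Sahi cell, seat `prim-sahi-p1`, generation 18; `--supports stmt-CriticalPhenomena-4575`).  Pure proofs, NO definitions, no `sorry`,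
standard axioms.  Vocabulary of `…SahiGridPattern{,SliceForm,Theta,YProfile,MeetFace,ZeroLocusIndep}` (`yProfile`, `thetaVal`, `nuCount`, `ind`, `TotDist`).

THE MATHEMATICS.  `N(X;Y)` = totally distinct pairs in `X × Y`, `H(X,Y) = 2^d·#(X∩Y) − N(X;Y) ≥ 0` the coefficientwise Harris slack of up-sets.
The tree's meet face (prim-ineq-gen-4 g12, `sStarD_univ_le_of_inter_subset`) is `A∩B ⊆ C ⟹ sStarD A B C ≥ sStarD A B ⊤ = H(A,B)`.  THIS FILE
sharpens it by `N(A; B∖C) ≥ 0`: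
  **`A ∩ B ⊆ C ⟹ 2^d·#(A∩B∩C) ≤ sStarD A B C + N(A; B∩C)`**, i.e. `sStarD A B C ≥ H(A, B∩C)` (`harrisSlack_le_sStarD_of_inter_subset`),
for up-sets `A, B` and ANY finset `C ⊇ A∩B` (and `≥ H(B, A∩C)` by the slot symmetry).  Proof (every `d`, five lines): by the y-profile
`sStarD A B C = Σ_{y∈C} P_y(A,B)` with `P_y = [y∈B](2·2^d·1_A(y) − ν_A(y)) − Σ_{q∈B} Θ_A(q,y)` (`yProfile_eq`), the REDUCED profile
`Q_y := P_y − [y∈B](2^d·1_A(y) − ν_A(y)) = [y∈B]·2^d·1_A(y) − Σ_{q∈B} Θ_A(q,y)` has `Σ_{y∈C} Q_y = sStarD A B C − H(A,B∩C)`; by Θ-column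
positivity (`sum_thetaVal_col_nonneg`) `Q_y ≤ 0` OFF `A∩B`, and `Σ_{all y} Q_y = sStarD A B ⊤ − H(A,B) = 0` (`sStarD_univ_eq_harrisSlack`); so for
`C ⊇ A∩B`, `Σ_{y∈C} Q_y = −Σ_{y∉C} Q_y ≥ 0`.  More precisely the reduced functional is ANTITONE off the meet (`reducedProfile_sum_anti_off_meet`).
Generation-18 census of 'S ≥ named slack' (seat `code/gen18/c/faces.c`, 240 000 exact random triples, `d = 3, 4`): on the meet face `S ≥ H(A,B∩C)` and
`S ≥ H(B,A∩C)` hold with minimum margin `0`, while `S ≥ H(C,A∩B)` and `S ≥ H(A,B∩C)+H(B,A∩C)` FAIL there, and `S ≥ min(H_A,H_B,H_C)` fails off the faces;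
companion theorem for the orthant slot: `sStarD_principal_ge_harris` (`…OrthantHarris`).  Nothing here asserts `PatternPos d` for `d ≥ 4`. [this work]
-/

namespace Summit.CriticalPhenomena.PercolationContinuityZ3.Theorems.SahiGridPattern

open Finset SahiGrid3
open scoped BigOperators

variable {d : ℕ}

/-- **The reduced y-profile is nonpositive off the meet**: for up-sets `A, B` and `y ∉ A ∩ B`,
`P_y(A,B) − [y∈B]·(2^d·1_A(y) − ν_A(y)) = [y∈B]·2^d·1_A(y) − Σ_{q∈B} Θ_A(q,y) ≤ 0` (Θ-column positivity). [this work] -/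
theorem reducedProfile_nonpos_of_not_mem {A B : Finset (Pd d)} (hA : IsUpperSet (A : Set (Pd d))) (hB : IsUpperSet (B : Set (Pd d)))
    {y : Pd d} (hy : y ∉ A ∩ B) :
    yProfile A B y - ind B y * ((2:ℤ) ^ d * ind A y - (nuCount A y : ℤ)) ≤ 0 := by
  rw [yProfile_eq]
  have hθ := sum_thetaVal_col_nonneg hA hB y
  by_cases hyB : y ∈ B
  · have hyA : y ∉ A := fun h => hy (mem_inter.2 ⟨h, hyB⟩)
    have hA0 : ind A y = 0 := by unfold ind; rw [if_neg hyA]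
    have hB1 : ind B y = 1 := by unfold ind; rw [if_pos hyB]
    rw [if_pos hyB, hA0, hB1]
    linarith
  · have hB0 : ind B y = 0 := by unfold ind; rw [if_neg hyB]
    rw [if_neg hyB, hB0]
    linarith

/-- The Harris slack of `A` against `B ∩ C` in the indicator language: `Σ_{y∈C} 1_B(y)(2^d·1_A(y) − ν_A(y)) = 2^d·Σ_{y∈C} 1_A1_B − Σ_{y∈C} 1_B ν_A`
(bookkeeping). [this work] -/
theorem sum_ind_mul_harris (A B C : Finset (Pd d)) :
    (∑ y ∈ C, ind B y * ((2:ℤ) ^ d * ind A y - (nuCount A y : ℤ))) =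
      2 ^ d * (∑ y ∈ C, ind A y * ind B y) - ∑ y ∈ C, ind B y * (nuCount A y : ℤ) := by
  rw [Finset.mul_sum, ← Finset.sum_sub_distrib]
  exact Finset.sum_congr rfl fun y _ => by ring

/-- **The reduced functional vanishes on the whole cube**: `Σ_y [P_y(A,B) − 1_B(y)(2^d·1_A(y) − ν_A(y))] = sStarD A B ⊤ − H(A,B) = 0`. [this work] -/
theorem sum_reducedProfile_univ (A B : Finset (Pd d)) :
    (∑ y, (yProfile A B y - ind B y * ((2:ℤ) ^ d * ind A y - (nuCount A y : ℤ)))) = 0 := by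
  rw [Finset.sum_sub_distrib, ← sStarD_eq_sum_yProfile, sStarD_univ_eq_harrisSlack, sum_ind_mul_harris]
  -- `Σ_y 1_B(y) ν_A(y) = Σ_p Σ_q 1_A(p) 1_B(q) [p δ̸ q]`
  have hnu : (∑ y : Pd d, ind B y * (nuCount A y : ℤ)) = ∑ p, ∑ q, ind A p * ind B q * (if TotDist p q = true then (1:ℤ) else 0) := by
    rw [Finset.sum_comm]
    refine Finset.sum_congr rfl fun y _ => ?_
    have e : (nuCount A y : ℤ) = ∑ p, ind A p * (if TotDist p y = true then (1:ℤ) else 0) := by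
      unfold nuCount ind
      rw [Finset.card_filter, Nat.cast_sum]
      symm
      rw [← Finset.sum_subset (Finset.subset_univ A) (fun p _ hp => by rw [if_neg hp, zero_mul])]
      refine Finset.sum_congr rfl fun p hp => ?_
      rw [if_pos hp, one_mul]
      split_ifs <;> simp
    rw [e, Finset.mul_sum]
    exact Finset.sum_congr rfl fun p _ => by ring
  rw [hnu]
  ring

/-- **The reduced functional is antitone off the meet**: if `C ⊆ C'` and `C' ∖ C` misses `A ∩ B`, then
`Σ_{y∈C'} Q_y ≤ Σ_{y∈C} Q_y` for the reduced profile `Q_y = P_y(A,B) − 1_B(y)(2^d·1_A(y) − ν_A(y))`. [this work] -/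
theorem reducedProfile_sum_anti_off_meet {A B C C' : Finset (Pd d)} (hA : IsUpperSet (A : Set (Pd d))) (hB : IsUpperSet (B : Set (Pd d)))
    (hCC' : C ⊆ C') (h : ∀ y ∈ C', y ∉ C → y ∉ A ∩ B) :
    (∑ y ∈ C', (yProfile A B y - ind B y * ((2:ℤ) ^ d * ind A y - (nuCount A y : ℤ)))) ≤
      ∑ y ∈ C, (yProfile A B y - ind B y * ((2:ℤ) ^ d * ind A y - (nuCount A y : ℤ))) := by
  rw [← Finset.sum_sdiff hCC']
  have hneg : (∑ y ∈ C' \ C, (yProfile A B y - ind B y * ((2:ℤ) ^ d * ind A y - (nuCount A y : ℤ)))) ≤ 0 :=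
    Finset.sum_nonpos fun y hy => by
      rw [Finset.mem_sdiff] at hy
      exact reducedProfile_nonpos_of_not_mem hA hB (h y hy.1 hy.2)
  linarith

/-- **THE MEET FACE DOMINATES ITS HARRIS SLACK** (every dimension, indicator form): for up-sets `A, B ⊆ [3]^d` and ANY finset `C ⊇ A ∩ B`,
`2^d · Σ_{y∈C} 1_A1_B ≤ sStarD A B C + Σ_{y∈C} 1_B(y)·ν_A(y)`, i.e. `2^d·#(A∩B∩C) ≤ sStarD A B C + N(A; B∩C)`. [this work] -/
theorem sStarD_ge_harris_of_inter_subset {A B C : Finset (Pd d)} (hA : IsUpperSet (A : Set (Pd d))) (hB : IsUpperSet (B : Set (Pd d)))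
    (h : A ∩ B ⊆ C) :
    2 ^ d * (∑ y ∈ C, ind A y * ind B y) ≤ sStarD A B C + ∑ y ∈ C, ind B y * (nuCount A y : ℤ) := by
  have h1 := reducedProfile_sum_anti_off_meet hA hB (Finset.subset_univ C) fun y _ hyC hyAB => hyC (h hyAB)
  rw [sum_reducedProfile_univ] at h1
  rw [Finset.sum_sub_distrib, ← sStarD_eq_sum_yProfile, sum_ind_mul_harris] at h1
  linarith

/-- Cardinality bookkeeping: `Σ_{y∈C} 1_A 1_B = #(A ∩ B ∩ C)`. [this work] -/
theorem sum_ind_mul_ind_mem_eq_card (A B C : Finset (Pd d)) : (∑ y ∈ C, ind A y * ind B y) = ((A ∩ B ∩ C).card : ℤ) := by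
  rw [show (∑ y ∈ C, ind A y * ind B y) = ∑ y ∈ C, ind (A ∩ B) y from
    Finset.sum_congr rfl fun y _ => (ind_inter_eq_mul A B y).symm]
  unfold ind
  rw [Finset.sum_boole, Finset.filter_mem_eq_inter, Finset.inter_comm]

/-- Cardinality bookkeeping: `Σ_{y∈C} 1_B(y) ν_A(y) = #{(x,y) ∈ A × (B ∩ C) : x δ̸ y} = N(A; B∩C)`. [this work] -/
theorem sum_ind_mul_nuCount_eq_card (A B C : Finset (Pd d)) :
    (∑ y ∈ C, ind B y * (nuCount A y : ℤ)) = (((A ×ˢ (B ∩ C)).filter fun xy => TotDist xy.1 xy.2 = true).card : ℤ) := by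
  have e1 : (∑ y ∈ C, ind B y * (nuCount A y : ℤ)) = ∑ y ∈ B ∩ C, (nuCount A y : ℤ) := by
    rw [Finset.inter_comm, ← Finset.filter_mem_eq_inter, Finset.sum_filter]
    refine Finset.sum_congr rfl fun y _ => ?_
    unfold ind
    split_ifs <;> simp
  rw [e1]
  unfold nuCount
  rw [Finset.card_filter, Nat.cast_sum, Finset.sum_product, Finset.sum_comm]
  refine Finset.sum_congr rfl fun q _ => ?_
  rw [Finset.card_filter, Nat.cast_sum]

/-- **THE MEET FACE DOMINATES ITS HARRIS SLACK** (every dimension, counting form): for up-sets `A, B ⊆ [3]^d` and any finset `C ⊇ A ∩ B`,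
`2^d·#(A∩B∩C) − #{(x,y) ∈ A × (B∩C) : x δ̸ y} ≤ sStarD A B C` — the meet face sharpened by `N(A; B∖C)` over `sStarD_univ_le_of_inter_subset`. [this work] -/
theorem harrisSlack_le_sStarD_of_inter_subset {A B C : Finset (Pd d)} (hA : IsUpperSet (A : Set (Pd d))) (hB : IsUpperSet (B : Set (Pd d)))
    (h : A ∩ B ⊆ C) :
    2 ^ d * ((A ∩ B ∩ C).card : ℤ) - ((((A ×ˢ (B ∩ C)).filter fun xy => TotDist xy.1 xy.2 = true).card : ℤ)) ≤ sStarD A B C := by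
  have h1 := sStarD_ge_harris_of_inter_subset hA hB h
  rw [sum_ind_mul_ind_mem_eq_card, sum_ind_mul_nuCount_eq_card] at h1
  linarith

/-- The same with the slack of the SECOND slot: `A ∩ B ⊆ C ⟹ 2^d·#(A∩B∩C) − N(B; A∩C) ≤ sStarD A B C`. [this work] -/
theorem harrisSlack_le_sStarD_of_inter_subset₂ {A B C : Finset (Pd d)} (hA : IsUpperSet (A : Set (Pd d))) (hB : IsUpperSet (B : Set (Pd d)))
    (h : A ∩ B ⊆ C) :
    2 ^ d * ((A ∩ B ∩ C).card : ℤ) - ((((B ×ˢ (A ∩ C)).filter fun xy => TotDist xy.1 xy.2 = true).card : ℤ)) ≤ sStarD A B C := by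
  rw [sStarD_swap12, show A ∩ B ∩ C = B ∩ A ∩ C by rw [Finset.inter_comm A B]]
  exact harrisSlack_le_sStarD_of_inter_subset hB hA (by rwa [Finset.inter_comm B A])

/-- **Comparable pair, sharpened** (`A ⊆ B`, `A, C` up-sets, `B` any finset): `2^d·#(A∩C) − N(C; A) ≤ sStarD A B C` (the slack of the third slot
against the small set), and `2^d·#(A∩C) − N(A; B∩C) ≤ sStarD A B C`. [this work] -/
theorem harrisSlack_le_sStarD_of_subset₁₂ {A B C : Finset (Pd d)} (hA : IsUpperSet (A : Set (Pd d)))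
    (hC : IsUpperSet (C : Set (Pd d))) (h : A ⊆ B) :
    2 ^ d * ((A ∩ C).card : ℤ) - ((((C ×ˢ A).filter fun xy => TotDist xy.1 xy.2 = true).card : ℤ)) ≤ sStarD A B C ∧
    2 ^ d * ((A ∩ C).card : ℤ) - ((((A ×ˢ (B ∩ C)).filter fun xy => TotDist xy.1 xy.2 = true).card : ℤ)) ≤ sStarD A B C := by
  have hAC : A ∩ C ⊆ B := fun y hy => h (Finset.mem_inter.1 hy).1
  have e1 : A ∩ C ∩ B = A ∩ C := Finset.inter_eq_left.2 hAC
  have e2 : A ∩ B = A := Finset.inter_eq_left.2 h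
  constructor
  · have h2 := harrisSlack_le_sStarD_of_inter_subset₂ hA hC hAC
    rw [sStarD_swap23]
    rw [e1, e2] at h2
    exact h2
  · have h1 := harrisSlack_le_sStarD_of_inter_subset hA hC hAC
    rw [sStarD_swap23]
    rw [e1, Finset.inter_comm C B] at h1
    exact h1

end Summit.CriticalPhenomena.PercolationContinuityZ3.Theorems.SahiGridPattern
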